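import Summits.Schanuel.Schanuel.Theorems.DiophantineDichotomyDefs
import Literature.NumberTheory.Transcendental.ExpAlgebraicTranscendenceMeasure

/-!
# Stub 4 of line `height-window-compactness`: `ExpFiniteType` from Waldschmidt's transcendence
# measure for `e^β` (1978)

Route `DiophantineDichotomy`, item `KhovanskiiApproxType` (stmt-Schanuel-6116), line
`height-window-compactness`, registered stub `stub_expFiniteType : ExpFiniteType` (Lang's FINITE
TYPE OF TRANSCENDENCE of `e^β` for non-zero algebraic `β`; vocabulary
`Theorems/DiophantineDichotomyDefs.lean`, namespace `…KhovanskiiApproxType.HeightWindowCompactness`).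

The stub is PRINTED.  Source READ this session (open-access copy, `lit read
10.1017/s1446788700021431`, pp. 445–446, 454–455): M. Waldschmidt, *Transcendence measures for
exponentials and logarithms*, J. Austral. Math. Soc. (A) 25 (1978) 445–465 [Waldschmidt1978].
Conventions (p. 445): for `φ(X, Y)` defined for `X ≥ 1`, `Y ≥ log 16`, "`φ` is a transcendence
measure for `ω` if `log|P(ω)| > −φ(N, log H)` for all non-trivial `P ∈ ℤ[X]` of degree `≤ N` and
(usual) height `≤ H`"; `Log₊ x = Log max(1, x)` (p. 446).  COROLLARY 3.9 (p. 455): "A transcendence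
measure for `e^β` is `8 C₁₆(β) N² (Log H + Log N)(Log Log H + Log N)² (Log Log H + Log₊ Log N)⁻²`"
(`β` a non-zero algebraic number, `C₁₆(β)` the explicit constant of p. 454; Fig. 1 p. 446 records
"type 3" for `e^β`).

* the corollary is the NAMED FACT `Literature.NumberTheory.Transcendental.Waldschmidt1978_cor_3_9`
  (constant existential, `>` weakened to `≥`; nothing more than print is claimed; vendored p95103,
  `Literature/NumberTheory/Transcendental/ExpAlgebraicTranscendenceMeasure.lean`, by accept-time
  relocation from this file's first submission).
* `expFiniteType_of_waldschmidt` — the fact implies `ExpFiniteType` with `τ = 5`: for `N ≥ 1`,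
  `H ≥ 16` one has `Log Log H + Log₊ Log N ≥ log log 16 > 1`, `log N ≤ N`, `log log H ≤ log H`, so
  the measure is `≤ 8C₁₆ (N + log H)⁵`; a coefficient bound `B ≥ 1` is replaced by
  `H = max 16 ⌈B⌉` with `log H ≤ log B + 4`, whence `(N + log H) ≤ 5 (N + log B)`.

Everything else is bookkeeping; no `sorry`; the named fact enters only as a hypothesis.
-/

noncomputable section

-- `Summit.Schanuel.Schanuel.…` is the mandated summit/sub-problem namespace (single-conjunct summit), hence:
set_option linter.dupNamespace false

namespace Summit.Schanuel.Schanuel.Cruxes.KhovanskiiApproxType.HeightWindowCompactness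

open Polynomial
open Literature.NumberTheory.Transcendental (Waldschmidt1978_cor_3_9)

namespace ExpFiniteTypeOfWaldschmidt

/-- `log log 16 > 1` (`log 16 = 4 log 2 > 4 · 0.6931 > e`). [folklore] -/
theorem one_lt_log_log_sixteen : (1 : ℝ) < Real.log (Real.log 16) := by
  have h2 : (0.6931471803 : ℝ) < Real.log 2 := Real.log_two_gt_d9
  have h16 : Real.log 16 = 4 * Real.log 2 := by
    rw [show (16 : ℝ) = 2 ^ 4 by norm_num, Real.log_pow]; norm_num
  have he : Real.exp 1 < Real.log 16 := by
    rw [h16]; have := Real.exp_one_lt_d9; linarith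
  rwa [Real.lt_log_iff_exp_lt (by rw [h16]; linarith)]

/-- WALDSCHMIDT'S SHAPE IS OF FINITE TYPE: for `N ≥ 1`, `H ≥ 16`, `C > 0`,
`C N² (log H + log N)(log log H + log N)² / (log log H + log max(1, log N))² ≤ C (N + log H)⁵`.
[folklore] -/
theorem waldschmidt_shape_le {C N H : ℝ} (hC : 0 < C) (hN : 1 ≤ N) (hH : 16 ≤ H) :
    C * N ^ 2 * (Real.log H + Real.log N) * (Real.log (Real.log H) + Real.log N) ^ 2 /
        (Real.log (Real.log H) + Real.log (max 1 (Real.log N))) ^ 2 ≤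
      C * (N + Real.log H) ^ 5 := by
  have hN0 : 0 < N := by linarith
  have hlogN0 : 0 ≤ Real.log N := Real.log_nonneg hN
  have hlogN : Real.log N ≤ N := (Real.log_le_sub_one_of_pos hN0).trans (by linarith)
  have hlogH16 : Real.log 16 ≤ Real.log H := Real.log_le_log (by norm_num) hH
  have hll : 1 < Real.log (Real.log H) :=
    one_lt_log_log_sixteen.trans_le
      (Real.log_le_log (Real.log_pos (by norm_num : (1 : ℝ) < 16)) hlogH16)
  have hlogH0 : 0 < Real.log H := by
    have := Real.log_pos (by norm_num : (1:ℝ) < 16); linarith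
  have hllH : Real.log (Real.log H) ≤ Real.log H :=
    (Real.log_le_sub_one_of_pos hlogH0).trans (by linarith)
  -- the denominator is `≥ 1`
  have hden1 : 1 ≤ Real.log (Real.log H) + Real.log (max 1 (Real.log N)) := by
    have : 0 ≤ Real.log (max 1 (Real.log N)) := Real.log_nonneg (le_max_left _ _)
    linarith
  have hden0 : 0 < (Real.log (Real.log H) + Real.log (max 1 (Real.log N))) ^ 2 := by positivity
  rw [div_le_iff₀ hden0]
  set X : ℝ := N + Real.log H with hX
  have hX1 : 1 ≤ X := by rw [hX]; linarith
  have hX0 : 0 ≤ X := by linarith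
  have hNX : N ≤ X := by rw [hX]; linarith
  have h1 : Real.log H + Real.log N ≤ X := by rw [hX]; linarith
  have h2 : Real.log (Real.log H) + Real.log N ≤ X := by rw [hX]; linarith
  have h20 : 0 ≤ Real.log (Real.log H) + Real.log N := by linarith
  have hnum : C * N ^ 2 * (Real.log H + Real.log N) * (Real.log (Real.log H) + Real.log N) ^ 2 ≤
      C * X ^ 5 := by
    have e5 : X ^ 5 = X ^ 2 * X * X ^ 2 := by ring
    rw [e5]
    have hN2 : N ^ 2 ≤ X ^ 2 := pow_le_pow_left₀ hN0.le hNX 2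
    have h22 : (Real.log (Real.log H) + Real.log N) ^ 2 ≤ X ^ 2 := pow_le_pow_left₀ h20 h2 2
    have hl0 : 0 ≤ Real.log H + Real.log N := by linarith
    calc C * N ^ 2 * (Real.log H + Real.log N) * (Real.log (Real.log H) + Real.log N) ^ 2
        = C * (N ^ 2 * (Real.log H + Real.log N) * (Real.log (Real.log H) + Real.log N) ^ 2) := by
          ring
      _ ≤ C * (X ^ 2 * X * X ^ 2) := by
          refine mul_le_mul_of_nonneg_left ?_ hC.le
          exact mul_le_mul (mul_le_mul hN2 h1 hl0 (by positivity)) h22 (by positivity)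
            (by positivity)
  calc C * N ^ 2 * (Real.log H + Real.log N) * (Real.log (Real.log H) + Real.log N) ^ 2
      ≤ C * X ^ 5 := hnum
    _ = C * X ^ 5 * 1 := (mul_one _).symm
    _ ≤ C * X ^ 5 * (Real.log (Real.log H) + Real.log (max 1 (Real.log N))) ^ 2 := by
        refine mul_le_mul_of_nonneg_left ?_ (by positivity)
        nlinarith

end ExpFiniteTypeOfWaldschmidt

open ExpFiniteTypeOfWaldschmidt

/-- **`ExpFiniteType` (stub 4 of line `height-window-compactness`) from Waldschmidt 1978,
Corollary 3.9**: for every non-zero algebraic `β`, `e^β` has Lang transcendence type `τ = 5`: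
`|P(e^β)| ≥ exp(−C'(N + log B)⁵)` for every non-zero `P ∈ ℤ[X]` of degree `≤ N` (`N ≥ 1`) with
coefficients `≤ B` (`B ≥ 1` real), `C' = 5⁵ C` — read the corollary at `H = max 16 ⌈B⌉`
(`log H ≤ log B + 4`, so `N + log H ≤ 5(N + log B)`). CONDITIONAL on the named fact
`Waldschmidt1978_cor_3_9` (registered sub-goal `expFiniteType_of_waldschmidt` of stub 4).
[cite: Waldschmidt1978, Corollary 3.9] -/
theorem expFiniteType_of_waldschmidt :
    Literature.NumberTheory.Transcendental.Waldschmidt1978_cor_3_9 → ExpFiniteType := by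
  intro hW β hβ hβ0
  obtain ⟨C, hC, hall⟩ := hW β hβ hβ0
  refine ⟨((5 : ℕ) : ℝ), 5 ^ 5 * C, by positivity, ?_⟩
  intro P N B hP hN hdeg hB hcoeff
  rw [Real.rpow_natCast]
  -- the integer height `H = max 16 ⌈B⌉`
  set H : ℕ := max 16 ⌈B⌉₊ with hHdef
  have hH16 : 16 ≤ H := le_max_left _ _
  have hBH : B ≤ (H : ℝ) := (Nat.le_ceil B).trans (by exact_mod_cast le_max_right 16 ⌈B⌉₊)
  have hcoeffH : ∀ k, |P.coeff k| ≤ (H : ℤ) := fun k => by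
    have h1 : ((|P.coeff k| : ℤ) : ℝ) ≤ B := by rw [Int.cast_abs]; exact hcoeff k
    exact_mod_cast h1.trans hBH
  have hw := hall P N H hP hN hdeg hH16 hcoeffH
  have hN1 : (1 : ℝ) ≤ N := by exact_mod_cast hN
  have hH16r : (16 : ℝ) ≤ H := by exact_mod_cast hH16
  have hshape := waldschmidt_shape_le hC hN1 hH16r
  -- `log H ≤ log B + 4`: `H ≤ 16 B + 17 ≤ 33 B` and `33 < e⁴`
  have hlogB : 0 ≤ Real.log B := Real.log_nonneg hB
  have hHle : (H : ℝ) ≤ 33 * B := by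
    have hc : (⌈B⌉₊ : ℝ) < B + 1 := Nat.ceil_lt_add_one (by linarith)
    have : (H : ℝ) ≤ max (16 : ℝ) (⌈B⌉₊ : ℝ) := by rw [hHdef]; push_cast; exact le_rfl
    have hm : max (16 : ℝ) (⌈B⌉₊ : ℝ) ≤ 33 * B := max_le (by linarith) (by linarith)
    linarith
  have he4 : (33 : ℝ) < Real.exp 4 := by
    have h1 : (2.7182818283 : ℝ) < Real.exp 1 := Real.exp_one_gt_d9
    have h4 : Real.exp 4 = Real.exp 1 ^ 4 := by
      rw [← Real.exp_nat_mul]; norm_num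
    rw [h4]
    have : (2.7182818283 : ℝ) ^ 4 < Real.exp 1 ^ 4 := pow_lt_pow_left₀ h1 (by norm_num) (by norm_num)
    linarith [show (33 : ℝ) < 2.7182818283 ^ 4 by norm_num]
  have hlogH : Real.log H ≤ Real.log B + 4 := by
    have hpos : (0 : ℝ) < H := by linarith
    have hB0 : 0 < B := by linarith
    calc Real.log H ≤ Real.log (33 * B) := Real.log_le_log hpos hHle
      _ = Real.log 33 + Real.log B := Real.log_mul (by norm_num) hB0.ne'
      _ ≤ 4 + Real.log B := by
          have : Real.log 33 < 4 := by
            rw [Real.log_lt_iff_lt_exp (by norm_num)]; exact he4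
          linarith
      _ = Real.log B + 4 := by ring
  -- `C (N + log H)^5 ≤ 5^5 C (N + log B)^5`
  have hX : (N : ℝ) + Real.log H ≤ 5 * ((N : ℝ) + Real.log B) := by linarith
  have hX0 : 0 ≤ (N : ℝ) + Real.log H := by
    have : 0 ≤ Real.log (H : ℝ) := Real.log_nonneg (by linarith)
    linarith
  have hfin : C * ((N : ℝ) + Real.log H) ^ 5 ≤ 5 ^ 5 * C * ((N : ℝ) + Real.log B) ^ 5 := by
    calc C * ((N : ℝ) + Real.log H) ^ 5 ≤ C * (5 * ((N : ℝ) + Real.log B)) ^ 5 :=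
          mul_le_mul_of_nonneg_left (pow_le_pow_left₀ hX0 hX 5) hC.le
      _ = 5 ^ 5 * C * ((N : ℝ) + Real.log B) ^ 5 := by ring
  exact le_trans (Real.exp_le_exp.2 (neg_le_neg (hshape.trans hfin))) hw

end Summit.Schanuel.Schanuel.Cruxes.KhovanskiiApproxType.HeightWindowCompactness

end
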